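import Summits.HubbardSuperconductivity.HubbardSuperconductivity.Theorems.FunctionFieldCertificateWindowInfraredBoundMesoscopicCeilingMajorant
import Summits.HubbardSuperconductivity.HubbardSuperconductivity.Theorems.FunctionFieldCertificateWindowInfraredBoundReductions
import Summits.HubbardSuperconductivity.HubbardSuperconductivity.Theorems.FunctionFieldCertificateAssemblyStructural
import HarnessLib

/-!
# Crux `WindowInfraredBound` (stmt-HubbardSuperconductivity-1089) — the MESOSCOPIC-CEILING glue, file 2 of 2:
# (MC) ⇒ the crux, and the window-free assembly (idea `mesoscopic-ceiling-block-coherence`, round 2, ideator 5)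

Support file (`--supports stmt-HubbardSuperconductivity-1089`; no definition, no named fact, sorry-free). File 1
(`FunctionFieldCertificateWindowInfraredBoundMesoscopicCeilingMajorant.lean`) proved the model-free Fejér MAJORANT
`Σ_{m ≠ 0, |q_m| ≤ ε} S_ψ(m) ≤ 16 · (T_R(ψ)/R² - S_ψ(0))` (`ε R ≤ 1`, `2R ≤ L`, every vector). Notation as there:
`T_R(ψ) = Σ_{x,y} Πᵢ (1 - |(y-x)ᵢ|_L/R)₊ Re⟨P_x ψ, P_y ψ⟩` is the Fejér box of route item `MesoscopicPairOrder`,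
`S_ψ(m) = pairStructureFactor dWaveFormFactor L ψ m`.

The MESOSCOPIC CEILING (MC), transfer target of the idea card: for all `U > 0`, `δ ∈ (0,1/2)` there are `C ≥ 0`,
`R₀`, `L₀` such that for every even `L ≥ L₀`, every normalised `(N_L, S^z = 0)`-sector ground state `ψ` of
`hubbardTorus 2 L 1 U` and every block scale `R₀ ≤ R ≤ L/2`:  `T_R(ψ)/R² - S_ψ(0) ≤ C L²/R`
("mesoscopic `d`-wave pair order exceeds the `k = 0` condensate by at most `C/R` per site"). It is taken below as an
INLINE hypothesis (no `def`), verbatim in the three theorems.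

* `wib_of_mesoscopicCeiling` — **(MC) ⇒ `FunctionFieldCertificate.WindowInfraredBound`** with `C_crux = 32 C`,
  `ε₀ = 1/(2(R₀+1))`: below `εL < 2π` the window is empty; otherwise `R := ⌊1/ε⌋ ≥ R₀`, `εR ≤ 1`,
  `2R ≤ 2/ε < 2π/ε ≤ L`, `1/R ≤ 2ε`, and the majorant. `kacWib_of_mesoscopicCeiling` is the KacWindowPenalty /
  GibbsMajorant copy (same term).
* `summit_of_mesoscopicPairOrder_of_mesoscopicCeiling` — the WINDOW-FREE assembly: `MesoscopicPairOrder` + (MC)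
  give the summit directly (`S_ψ(0) ≥ T_R/R² - CL²/R ≥ (m - C/R)L² ≥ (m/2)L²` once `R > 2C/m`, then the landed
  `FunctionFieldCertificateAssemblyStructural.hasLRO_of_uniform_groundState_bound`) — no `ε`, no window, no tail.

So (MC) is a block-language restatement target for the crux in the route's own vocabulary (the Fejér box of
`MesoscopicPairOrder`), certificate-shaped per block scale `R`. The triage found (MC) crux-EQUIVALENT (converse by
Abel summation of the window bounds against `|F_R(m)|² ≲ R²/|q_m|²`): a change of SHAPE, not of strength. Nothing
here claims the crux; the three theorems are reductions (conditional on the inline hypothesis by design).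

Sources: Kennedy–Lieb–Shastry, PRL 61 (1988) 2582 [KLS1988PRL]; Stein–Shakarchi, *Fourier Analysis*, Ch. 2;
Scalapino, Phys. Rep. 250 (1995) 329, §2 (pair-field LRO). All folklore bookkeeping over the tree's definitions.
-/

noncomputable section

-- summit = problem name (single-conjunct summit, D-0017): `HubbardSuperconductivity` occurs twice in the path
set_option linter.dupNamespace false

namespace Summit.HubbardSuperconductivity.HubbardSuperconductivity.Theorems.WindowInfraredBound

open Literature.MathematicalPhysics.QuantumLattice Literature.Probability.LatticeModels Matrix Finset
open scoped ComplexConjugate ComplexOrder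
open Summit.HubbardSuperconductivity.HubbardSuperconductivity.Theses


/-! ### (MC) ⇒ the crux, and the window-free assembly -/

section Composition

/-- A nonzero momentum label has `Σᵢ (valMinAbs mᵢ)² ≥ 1` (cf. `Negative/ParsevalCeiling`). [folklore] -/
private theorem mc_one_le_sum_valMinAbs_sq {L : ℕ} {m : TorusSite 2 L} (hm : m ≠ 0) :
    (1 : ℝ) ≤ ∑ i, (((m i).valMinAbs : ℤ) : ℝ) ^ 2 := by
  obtain ⟨i, hi⟩ : ∃ i, m i ≠ 0 := by
    by_contra h
    push Not at h
    exact hm (funext h)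
  have hv : (m i).valMinAbs ≠ 0 := fun h => hi ((ZMod.valMinAbs_eq_zero (m i)).1 h)
  have h1 : (1 : ℝ) ≤ (((m i).valMinAbs : ℤ) : ℝ) ^ 2 := by
    have : (1 : ℤ) ≤ (m i).valMinAbs ^ 2 := by
      have := Int.one_le_abs hv
      nlinarith [abs_nonneg ((m i).valMinAbs), sq_abs ((m i).valMinAbs)]
    exact_mod_cast this
  exact h1.trans (Finset.single_le_sum (f := fun i => (((m i).valMinAbs : ℤ) : ℝ) ^ 2)
    (fun _ _ => sq_nonneg _) (Finset.mem_univ i))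

/-- **Empty window below `εL < 2π`**: if `ε² < (2π/L)²` the punctured window `{m ≠ 0, |q_m| ≤ ε}` is empty,
so the window sum vanishes (the smallest nonzero `|q_m|` is `2π/L`). [folklore] -/
private theorem mc_windowSum_eq_zero_of_sq_lt (g : Site 2 → ℝ) {L : ℕ} [NeZero L] {ε : ℝ}
    (hε : ε ^ 2 < (2 * Real.pi / (L : ℝ)) ^ 2) (ψ : Fock (Orb (FermionTorus 2 L))) :
    (∑ m : TorusSite 2 L, if m ≠ 0 ∧ momentumNormSq L m ≤ ε ^ 2 then pairStructureFactor g L ψ m else 0) = 0 := by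
  refine Finset.sum_eq_zero fun m _ => ?_
  rw [if_neg]
  rintro ⟨hm, hle⟩
  have h1 := mc_one_le_sum_valMinAbs_sq hm
  have hpos : 0 ≤ (2 * Real.pi / (L : ℝ)) ^ 2 := sq_nonneg _
  have : (2 * Real.pi / (L : ℝ)) ^ 2 ≤ momentumNormSq L m := by
    rw [momentumNormSq_apply]
    nlinarith
  linarith

/-- **(MC) ⇒ `WindowInfraredBound`.** The MESOSCOPIC CEILING — for all `U > 0`, `δ ∈ (0,1/2)` there are
`C ≥ 0`, `R₀`, `L₀` such that for every even `L ≥ L₀`, every normalised `(N_L, S^z = 0)`-sector ground state `ψ`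
of `hubbardTorus 2 L 1 U` and every block scale `R₀ ≤ R ≤ L/2`, `T_R(ψ)/R² - S_ψ(0) ≤ C L²/R` (mesoscopic `d`-wave
pair order exceeds the `k = 0` condensate by at most `C/R` per site) — implies the crux, with `C_crux = 32 C` and
`ε₀ = 1/(2(R₀+1))`: for `ε L < 2π` the window is empty; otherwise take `R := ⌊1/ε⌋ ≥ R₀`, so `εR ≤ 1`,
`2R ≤ 2/ε < 2π/ε ≤ L`, `1/R ≤ 2ε`, and apply `windowSum_le_fejerMajorant`. (MC) is the "forward restatement"
of idea `mesoscopic-ceiling-block-coherence` (triage r2: crux-equivalent, certificate-shaped per `R`). [folklore] -/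
theorem wib_of_mesoscopicCeiling : (∀ U : ℝ, 0 < U → ∀ δ ∈ Set.Ioo (0:ℝ) (1 / 2), ∃ C : ℝ, 0 ≤ C ∧ ∃ R₀ L₀ : ℕ, ∀ (L : ℕ) [NeZero L], L₀ ≤ L → Even L → ∀ ψ : Fock (Orb (FermionTorus 2 L)), star ψ ⬝ᵥ ψ = 1 → IsGroundStateInSector (hubbardTorus 2 L 1 U) (2 * ⌊(1 - δ) * (L : ℝ) ^ 2 / 2⌋₊) 0 ψ → ∀ R : ℕ, R₀ ≤ R → 2 * R ≤ L → (∑ x : TorusSite 2 L, ∑ y : TorusSite 2 L, (∏ i : Fin 2, max 0 (1 - |(((y i - x i).valMinAbs : ℤ) : ℝ)| / (R : ℝ))) * (star (localPair dWaveFormFactor L x *ᵥ ψ) ⬝ᵥ (localPair dWaveFormFactor L y *ᵥ ψ)).re) / (R : ℝ) ^ 2 - pairStructureFactor dWaveFormFactor L ψ 0 ≤ C * (L : ℝ) ^ 2 / (R : ℝ)) → FunctionFieldCertificate.WindowInfraredBound := by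
  intro hMC
  rw [wib_iff_pairStructureFactor]
  intro U hU δ hδ
  obtain ⟨C, hC, R₀, L₀, h⟩ := hMC U hU δ hδ
  have hR₀1 : (0 : ℝ) < 2 * ((R₀ : ℝ) + 1) := by positivity
  refine ⟨32 * C, 1 / (2 * ((R₀ : ℝ) + 1)), by positivity, by positivity, L₀, ?_⟩
  intro ε hε L _ hL₀ hev ψ hψ hgs
  obtain ⟨hεpos, hεle⟩ := hε
  have hLpos : (0 : ℝ) < L := Nat.cast_pos.2 (Nat.pos_of_ne_zero (NeZero.ne L))
  have hnonneg : 0 ≤ 32 * C * ε * (L : ℝ) ^ 2 := by positivity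
  by_cases hwin : ε ^ 2 < (2 * Real.pi / (L : ℝ)) ^ 2
  · rw [mc_windowSum_eq_zero_of_sq_lt dWaveFormFactor hwin ψ]
    exact hnonneg
  · -- the window is nonempty only if `2π/L ≤ ε`, i.e. `2π/ε ≤ L`
    have hεL : 2 * Real.pi / (L : ℝ) ≤ ε :=
      (pow_le_pow_iff_left₀ (by positivity) hεpos.le two_ne_zero).1 (not_lt.1 hwin)
    -- facts about `ε`: `ε ≤ 1/2`, `1/ε ≥ 2(R₀+1)`
    have hε2 : 2 * ((R₀ : ℝ) + 1) ≤ 1 / ε := by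
      rw [le_div_iff₀ hεpos]
      calc 2 * ((R₀ : ℝ) + 1) * ε ≤ 2 * ((R₀ : ℝ) + 1) * (1 / (2 * ((R₀ : ℝ) + 1))) :=
            mul_le_mul_of_nonneg_left hεle hR₀1.le
        _ = 1 := by field_simp
    have hinv2 : (2 : ℝ) ≤ 1 / ε := le_trans (by nlinarith [(Nat.cast_nonneg R₀ : (0:ℝ) ≤ R₀)]) hε2
    -- the block scale
    set R : ℕ := ⌊1 / ε⌋₊ with hRdef
    have hRle : (R : ℝ) ≤ 1 / ε := Nat.floor_le (by positivity)
    have hRgt : 1 / ε - 1 < (R : ℝ) := by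
      have := Nat.lt_floor_add_one (1 / ε)
      rw [← hRdef] at this
      linarith
    have hR₀R : R₀ ≤ R := by
      have : (R₀ : ℝ) < R := by linarith [(Nat.cast_nonneg R₀ : (0:ℝ) ≤ R₀)]
      exact_mod_cast this.le
    have hRpos' : (1 : ℝ) ≤ R := by linarith
    have hRpos : 0 < R := by exact_mod_cast (show (0 : ℝ) < R by linarith)
    have hRr : (0 : ℝ) < R := Nat.cast_pos.2 hRpos
    have hεR : ε * R ≤ 1 := by
      calc ε * R ≤ ε * (1 / ε) := mul_le_mul_of_nonneg_left hRle hεpos.le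
        _ = 1 := by field_simp
    have h2R : 2 * R ≤ L := by
      have h1 : 2 * (R : ℝ) ≤ 2 / ε := by
        calc 2 * (R : ℝ) ≤ 2 * (1 / ε) := by linarith
          _ = 2 / ε := by ring
      have h2 : 2 / ε < 2 * Real.pi / ε := by
        rw [div_lt_div_iff_of_pos_right hεpos]
        linarith [Real.pi_gt_three]
      have h3 : 2 * Real.pi / ε ≤ L := by
        rw [div_le_iff₀ hεpos]
        rw [div_le_iff₀ hLpos] at hεL
        linarith
      have : (2 * R : ℕ) < (L : ℝ) := by push_cast; linarith
      exact_mod_cast this.le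
    have hinvR : 1 / (R : ℝ) ≤ 2 * ε := by
      -- `2R > 2/ε - 2 ≥ 1/ε` since `1/ε ≥ 2`
      have h1 : 1 / ε < 2 * (R : ℝ) := by linarith
      have hεne : ε ≠ 0 := hεpos.ne'
      have h2 : (1 : ℝ) < 2 * ε * R :=
        calc (1 : ℝ) = ε * (1 / ε) := by field_simp
          _ < ε * (2 * (R : ℝ)) := mul_lt_mul_of_pos_left h1 hεpos
          _ = 2 * ε * R := by ring
      rw [div_le_iff₀ hRr]
      linarith
    -- the majorant and the ceiling
    have hmaj := windowSum_le_fejerMajorant dWaveFormFactor L R hRpos h2R ε hεpos hεR ψ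
    have hceil := h L hL₀ hev ψ hψ hgs R hR₀R h2R
    have hCR : C * (L : ℝ) ^ 2 / (R : ℝ) ≤ 2 * ε * (C * (L : ℝ) ^ 2) := by
      rw [div_eq_mul_one_div, mul_comm]
      exact mul_le_mul_of_nonneg_right hinvR (by positivity)
    calc _ ≤ 16 * (C * (L : ℝ) ^ 2 / (R : ℝ)) := hmaj.trans (mul_le_mul_of_nonneg_left hceil (by norm_num))
      _ ≤ 16 * (2 * ε * (C * (L : ℝ) ^ 2)) := mul_le_mul_of_nonneg_left hCR (by norm_num)
      _ = 32 * C * ε * (L : ℝ) ^ 2 := by ring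

/-- The KacWindowPenalty / GibbsMajorant copy of `wib_of_mesoscopicCeiling` (same term,
`wib_functionField_iff_kac`). [folklore] -/
theorem kacWib_of_mesoscopicCeiling
    (hMC : ∀ U : ℝ, 0 < U → ∀ δ ∈ Set.Ioo (0:ℝ) (1 / 2), ∃ C : ℝ, 0 ≤ C ∧ ∃ R₀ L₀ : ℕ,
      ∀ (L : ℕ) [NeZero L], L₀ ≤ L → Even L → ∀ ψ : Fock (Orb (FermionTorus 2 L)), star ψ ⬝ᵥ ψ = 1 →
        IsGroundStateInSector (hubbardTorus 2 L 1 U) (2 * ⌊(1 - δ) * (L : ℝ) ^ 2 / 2⌋₊) 0 ψ →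
          ∀ R : ℕ, R₀ ≤ R → 2 * R ≤ L →
            (∑ x : TorusSite 2 L, ∑ y : TorusSite 2 L,
                (∏ i : Fin 2, max 0 (1 - |(((y i - x i).valMinAbs : ℤ) : ℝ)| / (R : ℝ))) *
                  (star (localPair dWaveFormFactor L x *ᵥ ψ) ⬝ᵥ (localPair dWaveFormFactor L y *ᵥ ψ)).re) /
                (R : ℝ) ^ 2 - pairStructureFactor dWaveFormFactor L ψ 0 ≤ C * (L : ℝ) ^ 2 / (R : ℝ)) :
    KacWindowPenalty.WindowInfraredBound :=
  wib_functionField_iff_kac.1 (wib_of_mesoscopicCeiling hMC)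

/-- **Window-free assembly: `MesoscopicPairOrder` + (MC) ⇒ the summit.** At the `(U, δ, m)` of
`MesoscopicPairOrder` take the (MC) constants `C, R₀', L₀'`, ask `MesoscopicPairOrder` for a block scale
`R ≥ max R₀' (⌈2C/m⌉ + 1)`; then in every normalised sector ground state of every large even `L`,
`S_ψ(0) ≥ T_R(ψ)/R² - C L²/R ≥ m L² - (m/2) L²`, i.e. `Re⟨ψ, Δ_dᴴ Δ_d ψ⟩ ≥ (m/2) L⁴`, and the landed
`hasLRO_of_uniform_groundState_bound` gives `d`-wave pair LRO along even sides. No window, no `ε`: with (MC)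
in place of the crux the route's Fejér–Parseval window/tail bookkeeping is unnecessary. [folklore] -/
theorem summit_of_mesoscopicPairOrder_of_mesoscopicCeiling
    (hMeso : FunctionFieldCertificate.MesoscopicPairOrder)
    (hMC : ∀ U : ℝ, 0 < U → ∀ δ ∈ Set.Ioo (0:ℝ) (1 / 2), ∃ C : ℝ, 0 ≤ C ∧ ∃ R₀ L₀ : ℕ,
      ∀ (L : ℕ) [NeZero L], L₀ ≤ L → Even L → ∀ ψ : Fock (Orb (FermionTorus 2 L)), star ψ ⬝ᵥ ψ = 1 →
        IsGroundStateInSector (hubbardTorus 2 L 1 U) (2 * ⌊(1 - δ) * (L : ℝ) ^ 2 / 2⌋₊) 0 ψ →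
          ∀ R : ℕ, R₀ ≤ R → 2 * R ≤ L →
            (∑ x : TorusSite 2 L, ∑ y : TorusSite 2 L,
                (∏ i : Fin 2, max 0 (1 - |(((y i - x i).valMinAbs : ℤ) : ℝ)| / (R : ℝ))) *
                  (star (localPair dWaveFormFactor L x *ᵥ ψ) ⬝ᵥ (localPair dWaveFormFactor L y *ᵥ ψ)).re) /
                (R : ℝ) ^ 2 - pairStructureFactor dWaveFormFactor L ψ 0 ≤ C * (L : ℝ) ^ 2 / (R : ℝ)) :
    _root_.HubbardSuperconductivity := by
  obtain ⟨U, hU, δ, hδ, m, hm, hM⟩ := hMeso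
  obtain ⟨C, hC, R₀', L₀', hmc⟩ := hMC U hU δ hδ
  obtain ⟨R, hR₀R, L₁, hMR⟩ := hM (max R₀' (⌈2 * C / m⌉₊ + 1))
  have hR₀'R : R₀' ≤ R := le_trans (le_max_left _ _) hR₀R
  have hRceil : ⌈2 * C / m⌉₊ + 1 ≤ R := le_trans (le_max_right _ _) hR₀R
  have hRpos : 0 < R := by omega
  have hRr : (0 : ℝ) < R := Nat.cast_pos.2 hRpos
  have hCR : C / (R : ℝ) ≤ m / 2 := by
    have h1 : 2 * C / m ≤ (R : ℝ) :=
      (Nat.le_ceil _).trans (by exact_mod_cast (by omega : ⌈2 * C / m⌉₊ ≤ R))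
    rw [div_le_iff₀ hm] at h1
    rw [div_le_iff₀ hRr]
    linarith
  -- the uniform every-ground-state bound at `(U, δ)`
  have key : ∀ (L : ℕ) [NeZero L], max (max L₁ L₀') (2 * R) ≤ L → Even L →
      ∀ ψ : Fock (Orb (FermionTorus 2 L)),
      IsGroundStateInSector (hubbardTorus 2 L 1 U) (2 * ⌊(1 - δ) * (L : ℝ) ^ 2 / 2⌋₊) 0 ψ →
      star ψ ⬝ᵥ ψ = 1 →
      m / 2 * (L : ℝ) ^ 4 ≤
        (star ψ ⬝ᵥ ((pairField dWaveFormFactor L)ᴴ * pairField dWaveFormFactor L) *ᵥ ψ).re := by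
    intro L _ hL hev ψ hgs hψ
    have hL₁ : L₁ ≤ L := le_trans (le_trans (le_max_left _ _) (le_max_left _ _)) hL
    have hL₀' : L₀' ≤ L := le_trans (le_trans (le_max_right _ _) (le_max_left _ _)) hL
    have h2R : 2 * R ≤ L := le_trans (le_max_right _ _) hL
    have hLr : (0 : ℝ) < L := Nat.cast_pos.2 (Nat.pos_of_ne_zero (NeZero.ne L))
    set T : ℝ := ∑ x : TorusSite 2 L, ∑ y : TorusSite 2 L,
        (∏ i : Fin 2, max 0 (1 - |(((y i - x i).valMinAbs : ℤ) : ℝ)| / (R : ℝ))) *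
          (star (localPair dWaveFormFactor L x *ᵥ ψ) ⬝ᵥ (localPair dWaveFormFactor L y *ᵥ ψ)).re with hT
    -- crux 2: `m R² ≤ T / L²`
    have hmeso : m * (R : ℝ) ^ 2 ≤ T / (L : ℝ) ^ 2 := hMR L hL₁ hev ψ hψ hgs
    -- (MC): `T/R² - S(0) ≤ C L²/R`
    have hceil : T / (R : ℝ) ^ 2 - pairStructureFactor dWaveFormFactor L ψ 0 ≤ C * (L : ℝ) ^ 2 / (R : ℝ) :=
      hmc L hL₀' hev ψ hψ hgs R hR₀'R h2R
    have hS0 := pairStructureFactor_zero dWaveFormFactor L ψ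
    -- `T/R² ≥ m L²`
    have hTR : m * (L : ℝ) ^ 2 ≤ T / (R : ℝ) ^ 2 := by
      rw [le_div_iff₀ (by positivity)] at hmeso ⊢
      linarith
    -- `C L²/R ≤ (m/2) L²`
    have hCL : C * (L : ℝ) ^ 2 / (R : ℝ) ≤ m / 2 * (L : ℝ) ^ 2 := by
      rw [mul_div_right_comm]
      exact mul_le_mul_of_nonneg_right hCR (by positivity)
    have hS : m / 2 * (L : ℝ) ^ 2 ≤ pairStructureFactor dWaveFormFactor L ψ 0 := by linarith
    rw [hS0, le_div_iff₀ (by positivity)] at hS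
    have hE : m / 2 * (L : ℝ) ^ 4 ≤
        (expect ((pairField dWaveFormFactor L)ᴴ * pairField dWaveFormFactor L) ψ).re := by
      calc m / 2 * (L : ℝ) ^ 4 = m / 2 * (L : ℝ) ^ 2 * (L : ℝ) ^ 2 := by ring
        _ ≤ _ := hS
    exact hE
  -- conclude: the summit's matrix at `(U, δ)`
  show Literature.Hubbard.DWaveSuperconductivityHubbard
  exact ⟨U, hU, δ, hδ, fun N ψ hadm =>
    FunctionFieldCertificateAssemblyStructural.hasLRO_of_uniform_groundState_bound dWaveFormFactor
      (fun L => hubbardTorus 2 L 1 U)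
      (fun L => 2 * ⌊(1 - δ) * (L : ℝ) ^ 2 / 2⌋₊) 0 (m / 2) (by positivity) (max (max L₁ L₀') (2 * R))
      (fun L _ hL hev φ hgs hφ => key L hL hev φ hgs hφ) N ψ hadm⟩

end Composition

end Summit.HubbardSuperconductivity.HubbardSuperconductivity.Theorems.WindowInfraredBound

end
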